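import Summits.CriticalPhenomena.PercolationContinuityZ3.Theorems.Transplant.SkelFrmFromBChoiceBridge0
import Summits.CriticalPhenomena.PercolationContinuityZ3.Theorems.Transplant.SkelFrmFromBChoiceAtQPx
import HarnessLib

/-!
# GEN ROW (WAVE-Us-MANIFEST v1.0 §3/§9, INPUT layer) «SkelFrmFromBChoiceBridge0Px» — the GENERALISED twin of «SkelFrmFromBChoiceBridge0» §3 (`hbridge0*_of_atQ3`,
# the root-bridge links AT EVERY CENTRE) under `HasProxies t D` in place of `types = {t}` (hunk class 'h1 ↦ proxy package', option (a))

builds on p205010 (kernel theorem, internal audit signed; external expert review pending) — nothing in this file uses p205010.  The four `hbridge0` sentences of the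
U twin with the bridge radius slot `RB0 ↦ RB0 + D` (hunk (iv)), the zone family `Λ ∘ prox` (hunk (iii)) and the width floor `D ≤ nB0`; proofs = the U twin's,
reading the extra pair's input from «SkelFrmFromBChoiceAtQPx» (`inputsExtraAt_of_atQPx`, data `toDataN.proxR prox D`).  `oriφ_bridge0_eq_φL`, `sgQ_bridge0_eq_one`,
`KS.mem_of_Px0_subset` and the bridge parameters are used from the U twin / «SkelFrmFromBParamsBridge0» as they stand.  Nothing about any open node (U, U_s) is claimed.
[cite: KozmaNitzan2024, §4 pp. 19–21 ((21)–(25))] [this work]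
-/

noncomputable section

open scoped Classical

namespace Summit.CriticalPhenomena.PercolationContinuityZ3.Theorems.Transplant

open MeasureTheory Literature.Probability.Percolation Literature.Probability.LatticeModels SimpleGraph KNCells KNLevels
open Literature.Barriers.CriticalPhenomena (graphBall)
open SkelConc (Consts)
open Skelφ (oriφ trφ rootFrame pgSideHalfW pgramPrismFin)
open Skelφ.StepI (DataN DataNS OutNS)
open ChainPlanar (BridgePrm BridgeOK)

namespace PlanarSkeletonFrmFrom

namespace NegB

open Neg

section Bridge0Px

variable {κ : Consts} {V : Type} [DecidableEq V] [Countable V] {G : SimpleGraph V} [G.LocallyFinite] {Φ : PlanarSkeletonFrmFrom G} {t : V} {p : unitInterval}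
  {hC : Φ.CylSubcritical p} {gv fv : Neg.FSlot} {Pv : PSlot} {Sv : SSlot} {cv : CSlot} {bv : BSlot} {O : OutNS V} {q : unitInterval} {D : ℕ}

/-- [UNDER PROXIES: radius slot `RB0 + D`, zone family `Λ ∘ prox`, width floor `D ≤ nB0`] **`hbridge` FOR THE ROOT BRIDGE, LITERAL SHAPE**: at `Pv ⊇ Px0 mk`, for every `a ≥ δkit` and every centre `c`,
`1 − a³ < P_q(linkIn (pgramPrismFin G φL c nB0 hB0 (3ℓB0) RB0) (O.merged.Λ (hP.prox c) (Mu O.merged)) (pgSideHalfW G φL c nB0 hB0 ℓB0 RB0 1 1))` — the extra pair's served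
side half (near sign `1` by `sgQ_sel_eq_one`, map `φL` by `sel_ori`), at the cube accuracy, zone lifted from the seed level to `M_u`. [cite: KozmaNitzan2024, §4 pp. 19–21] -/
theorem hbridge0_of_atQ3Px (hAt : (choiceAtQ3 κ Φ t p Pv gv fv Sv cv bv hC).AtQNQ O q) (hP : Φ.HasProxies t D) (mk : ℕ)
    (hPx : (KS.Px0 mk κ Φ t p O.merged).1 ⊆ (Pv κ Φ t p O.merged).1) (hn : D ≤ KS.nB0 κ Φ t p O.merged mk) {a : ℝ} (ha : Neg.δkit κ Φ ≤ a) :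
    ∀ c : V, 1 - a ^ 3 < (bondPercolation G q).real
      (linkIn (↑(pgramPrismFin G (φL κ Φ t p O.D O.DT.toDataN O.ori (gOf κ Φ t p O gv) (fOf κ Φ t p O fv)) c (KS.nB0 κ Φ t p O.merged mk) (KS.hB0 κ Φ t p O.merged mk)
          (3 * KS.ℓB0 κ Φ t p O.merged mk) (KS.RB0 κ Φ t p O.merged mk + D)) : Set V)
        (O.merged.Λ (hP.prox c) (Mu O.merged))
        (pgSideHalfW G (φL κ Φ t p O.D O.DT.toDataN O.ori (gOf κ Φ t p O gv) (fOf κ Φ t p O fv)) c (KS.nB0 κ Φ t p O.merged mk) (KS.hB0 κ Φ t p O.merged mk)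
          (KS.ℓB0 κ Φ t p O.merged mk) (KS.RB0 κ Φ t p O.merged mk + D) 1 1)) := by
  intro c
  have h := inputsExtraAt_of_atQPx hAt hP c (KS.mem_of_Px0_subset κ Φ t p O.merged mk Pv hPx) hn 0 1
  rw [oriφ_bridge0_eq_φL hAt mk, sgQ_bridge0_eq_one hAt mk 0, Skelφ.StepI.eventNAt_some] at h
  unfold Skelφ.StepI.regionNAt Skelφ.StepI.pieceNAt at h
  rw [if_pos rfl, Units.val_one] at h
  rw [Skelφ.StepI.coe_pgramPrismFin]
  have hcube := δI3_le_cube_of_le κ Φ ha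
  refine lt_of_le_of_lt (by linarith) (h.trans_le (measureReal_mono ?_ (measure_ne_top _ _)))
  exact linkIn_mono le_rfl (zone_k_subset_zone_Mu hAt (hP.prox c)) subset_rfl

/-- [UNDER PROXIES: radius slot `RB0 + D`, zone family `Λ ∘ prox`, width floor `D ≤ nB0`] **`hbridge` FOR THE ROOT BRIDGE, zone AT THE SEED LEVEL `k`** ((R-42): the successor skeletons `…Q3K…` wire the fat seed at level `k`; Step I‴ serves
the link there natively — this is `hbridge0_of_atQ3Px` without the `M_u` lift). [cite: KozmaNitzan2024, §4 pp. 19–21] -/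
theorem hbridge0K_of_atQ3Px (hAt : (choiceAtQ3 κ Φ t p Pv gv fv Sv cv bv hC).AtQNQ O q) (hP : Φ.HasProxies t D) (mk : ℕ)
    (hPx : (KS.Px0 mk κ Φ t p O.merged).1 ⊆ (Pv κ Φ t p O.merged).1) (hn : D ≤ KS.nB0 κ Φ t p O.merged mk) {a : ℝ} (ha : Neg.δkit κ Φ ≤ a) :
    ∀ c : V, 1 - a ^ 3 < (bondPercolation G q).real
      (linkIn (↑(pgramPrismFin G (φL κ Φ t p O.D O.DT.toDataN O.ori (gOf κ Φ t p O gv) (fOf κ Φ t p O fv)) c (KS.nB0 κ Φ t p O.merged mk) (KS.hB0 κ Φ t p O.merged mk)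
          (3 * KS.ℓB0 κ Φ t p O.merged mk) (KS.RB0 κ Φ t p O.merged mk + D)) : Set V)
        (O.merged.Λ (hP.prox c) O.merged.k)
        (pgSideHalfW G (φL κ Φ t p O.D O.DT.toDataN O.ori (gOf κ Φ t p O gv) (fOf κ Φ t p O fv)) c (KS.nB0 κ Φ t p O.merged mk) (KS.hB0 κ Φ t p O.merged mk)
          (KS.ℓB0 κ Φ t p O.merged mk) (KS.RB0 κ Φ t p O.merged mk + D) 1 1)) := by
  intro c
  have h := inputsExtraAt_of_atQPx hAt hP c (KS.mem_of_Px0_subset κ Φ t p O.merged mk Pv hPx) hn 0 1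
  rw [oriφ_bridge0_eq_φL hAt mk, sgQ_bridge0_eq_one hAt mk 0, Skelφ.StepI.eventNAt_some] at h
  unfold Skelφ.StepI.regionNAt Skelφ.StepI.pieceNAt at h
  rw [if_pos rfl, Units.val_one] at h
  rw [Skelφ.StepI.coe_pgramPrismFin]
  have hcube := δI3_le_cube_of_le κ Φ ha
  exact lt_of_le_of_lt (by linarith) h

/-- [UNDER PROXIES: radius slot `RB0 + D`, zone family `Λ ∘ prox`, width floor `D ≤ nB0`] **`hbridge` at level `k` at the root accuracy `κ.δr 0`** (the `…Q3K…` skeletons' literal binder). [folklore] -/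
theorem hbridge0K_of_atQ3_δrPx (hAt : (choiceAtQ3 κ Φ t p Pv gv fv Sv cv bv hC).AtQNQ O q) (hP : Φ.HasProxies t D) (mk : ℕ)
    (hPx : (KS.Px0 mk κ Φ t p O.merged).1 ⊆ (Pv κ Φ t p O.merged).1) (hn : D ≤ KS.nB0 κ Φ t p O.merged mk) :
    ∀ c : V, 1 - κ.δr 0 ^ 3 < (bondPercolation G q).real
      (linkIn (↑(pgramPrismFin G (φL κ Φ t p O.D O.DT.toDataN O.ori (gOf κ Φ t p O gv) (fOf κ Φ t p O fv)) c (KS.nB0 κ Φ t p O.merged mk) (KS.hB0 κ Φ t p O.merged mk)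
          (3 * KS.ℓB0 κ Φ t p O.merged mk) (KS.RB0 κ Φ t p O.merged mk + D)) : Set V)
        (O.merged.Λ (hP.prox c) O.merged.k)
        (pgSideHalfW G (φL κ Φ t p O.D O.DT.toDataN O.ori (gOf κ Φ t p O gv) (fOf κ Φ t p O fv)) c (KS.nB0 κ Φ t p O.merged mk) (KS.hB0 κ Φ t p O.merged mk)
          (KS.ℓB0 κ Φ t p O.merged mk) (KS.RB0 κ Φ t p O.merged mk + D) 1 1)) :=
  hbridge0K_of_atQ3Px hAt hP mk hPx hn (Neg.δkit_le_δr κ Φ (n := 0) (by norm_num))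

/-- [UNDER PROXIES: radius slot `RB0 + D`, zone family `Λ ∘ prox`, width floor `D ≤ nB0`] **`hbridge` at the root accuracy `κ.δr 0`** (the skeletons' literal binder: `1 − (κ.δr 0)³ < …`). [folklore] -/
theorem hbridge0_of_atQ3_δrPx (hAt : (choiceAtQ3 κ Φ t p Pv gv fv Sv cv bv hC).AtQNQ O q) (hP : Φ.HasProxies t D) (mk : ℕ)
    (hPx : (KS.Px0 mk κ Φ t p O.merged).1 ⊆ (Pv κ Φ t p O.merged).1) (hn : D ≤ KS.nB0 κ Φ t p O.merged mk) :
    ∀ c : V, 1 - κ.δr 0 ^ 3 < (bondPercolation G q).real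
      (linkIn (↑(pgramPrismFin G (φL κ Φ t p O.D O.DT.toDataN O.ori (gOf κ Φ t p O gv) (fOf κ Φ t p O fv)) c (KS.nB0 κ Φ t p O.merged mk) (KS.hB0 κ Φ t p O.merged mk)
          (3 * KS.ℓB0 κ Φ t p O.merged mk) (KS.RB0 κ Φ t p O.merged mk + D)) : Set V)
        (O.merged.Λ (hP.prox c) (Mu O.merged))
        (pgSideHalfW G (φL κ Φ t p O.D O.DT.toDataN O.ori (gOf κ Φ t p O gv) (fOf κ Φ t p O fv)) c (KS.nB0 κ Φ t p O.merged mk) (KS.hB0 κ Φ t p O.merged mk)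
          (KS.ℓB0 κ Φ t p O.merged mk) (KS.RB0 κ Φ t p O.merged mk + D) 1 1)) :=
  hbridge0_of_atQ3Px hAt hP mk hPx hn (Neg.δkit_le_δr κ Φ (n := 0) (by norm_num))

end Bridge0Px

end NegB

end PlanarSkeletonFrmFrom

end Summit.CriticalPhenomena.PercolationContinuityZ3.Theorems.Transplant

end
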